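import Literature.NumberTheory.Transcendental.KaehlerHodge
import Literature.NumberTheory.Transcendental.KaehlerHodgeOfRealProofs
import Literature.NumberTheory.Transcendental.ComplexFormsProofs
import Literature.Geometry.Kaehler.ManifoldFormsChart
import Literature.Geometry.Kaehler.HodgeStarProofs
import Literature.Geometry.Kaehler.KaehlerProofs
import Mathlib.LinearAlgebra.Complex.Orientation
import Mathlib.LinearAlgebra.Complex.FiniteDimensional
import HarnessLib

/-!
# The named facts `typeComponent_mem_harmonicForms` / `typeComponent_mem_charmonicForms` are false as stated (the `{id, conj}` atlas on `ℂ`)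

Theorems-only companion of `Literature/NumberTheory/Transcendental/KaehlerHodge.lean` (C12).

That file records Voisin's Corollary 6.9 (Hodge Theory and Complex Algebraic Geometry I, §6.1.2,
p. 142 of the CUP edition: on a Kähler manifold, "if `α ∈ A^k(X)` is harmonic, its components
`α^{p,q}` are harmonic", a consequence of Thm. 6.7 `Δ_∂ = Δ_∂̄ = ½ Δ_d` / Cor. 6.8
"`Δ_d` is bihomogeneous") as the two named facts

* `Literature.NumberTheory.Transcendental.typeComponent_mem_charmonicForms` (complex form) and
* `Literature.NumberTheory.Transcendental.typeComponent_mem_harmonicForms` (real form: the real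
  and imaginary parts of `(β ⊗ 1)^{p,q}` of a real harmonic `β` are harmonic),

both written in a section `variable … [IsManifold 𝓘(ℂ, E) ω M] [IsManifold 𝓘(ℝ, E) ∞ M] (g …) (o …)`.
The body of neither `def … : Prop` mentions the complex-manifold instance, so — exactly as for
the former `isSmoothForm_kaehlerForm` of `Literature/Geometry/Kaehler/Kaehler.lean` (see the
*Correction* note there) — Lean did **not** abstract it: `#check @typeComponent_mem_harmonicForms`
lists `[ChartedSpace E M] [FiniteDimensional ℂ E] [Fact (finrank ℝ E = n)]
[IsManifold 𝓘(ℝ, E) ∞ M] (g) (o)` as the only hypotheses on `M`. The facts are therefore stated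
for every *real* `C^∞` manifold whose charts take values in a complex vector space `E`, with the
"complex structure" `Literature.Geometry.Kaehler.tangentJ` (= multiplication by `i` in the
coordinates of the *preferred chart* `chartAt x`) — which is not a tensor on `M` unless the
transition maps are holomorphic. This file proves that in that generality both facts are
**false** (`OriginConjAtlas.not_typeComponent_mem_harmonicForms_originConjAtlas`,
`OriginConjAtlas.not_typeComponent_mem_charmonicForms_originConjAtlas`), hence that no closed proofs
`typeComponent_mem_harmonicForms_holds` / `typeComponent_mem_charmonicForms_holds` can exist
(`not_forall_typeComponent_mem_harmonicForms`, `not_forall_typeComponent_mem_charmonicForms`).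
The intended statements carry `[IsManifold 𝓘(ℂ, E) ω M]` as a binder of the `def` itself (as
`Literature.Geometry.Kaehler.isSmoothForm_kaehlerForm_of_isManifold_complex` does); their proof
is Voisin's Thm. 6.7 (the Kähler identities), which the tree does not have yet.

## The counterexample (`namespace OriginConjAtlas`)

`Mc` is a copy of `ℂ` (a one-field structure, so that `chartedSpaceSelf ℂ` does not apply) with
the real-smooth, non-holomorphic atlas `{id, conj}` and the discontinuous choice of preferred
chart `chartAt 0 = conj`, `chartAt x = id` (`x ≠ 0`); it is a real `C^∞` manifold
(`IsManifold 𝓘(ℝ, ℂ) ∞ Mc`), and all its tangent coordinate changes are the constant maps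
`τ ∈ {id, conj}` (`Mc.coordChange_eq`).

* `metric`: the flat metric `Re ⟪·, ·⟫` on every `T_x Mc = ℂ`; in every trivialisation of the
  bundle of bilinear forms it is the *constant* `Re ⟪τ ·, τ ·⟫ = Re ⟪·, ·⟫` (`conj` is
  orthogonal), so it is a `C^∞` metric (`Bundle.ContMDiffRiemannianMetric`).
* `orient`: the standard orientation of `ℂ` read in the preferred charts (reversed at `0`); the
  Riemannian volume form has the constant representatives `± dx ∧ dy`, so the hypothesis `ho`
  holds (`isSmoothForm_riemannianVolumeForm`).
* `isKaehler`: the metric is Hermitian (`Re ⟪iv, iw⟫ = Re ⟪v, w⟫` pointwise) and its Kähler form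
  is the constant `dx ∧ dy` in chart coordinates; the chart representative at `x₀` is
  `± (dx ∧ dy)` according as `chartAt z = chartAt x₀` or not (`conj^*(dx ∧ dy) = -(dx ∧ dy)`):
  locally constant off the origin, and at the origin *discontinuous*, where
  `Literature.Geometry.Kaehler.mextDeriv` (Mathlib's `fderivWithin` of a non-differentiable
  function) returns the junk value `0` — so `IsClosedForm ω` (`= (mextDeriv ω = 0)`) holds.
* `dx`: the `1`-form `Re` (all representatives constant, `Re ∘ conj = Re`): smooth, `d dx = 0`,
  `⋆dx = ± Im` with constant representatives (`hodgeStar_apply_eq_areaForm_holds`), so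
  `δ dx = 0` and `Δ dx = 0`: `dx ∈ harmonicForms` (`k = 1`, `m = 1`, `n = 2`).
* `(dx ⊗ 1)^{1,0} = ½ dz` at every point (`IsOfType.typeComponent_eq_self`,
  `IsOfType.typeComponent_of_ne_holds` of `ComplexFormsProofs.lean`), whose imaginary part `½ Im`
  has, in the chart at the origin, the representative `½ Im` at the centre and `-½ Im` on the
  punctured plane: not continuous, hence not smooth, hence not in `harmonicForms`
  (whose elements are smooth) — contradicting the fact at `p = 1`, `q = 0`, `β = dx`.
  The same form refutes the complex version (`dx ⊗ 1 ∈ charmonicForms` by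
  `cHodgeLaplacian_ofReal_holds`, and `½ dz` is not smooth since its imaginary part is not).

No junk value enters except the one making `ω` closed at the origin, which is forced by the
statement under refutation (it quantifies over this `g`).

## References

* C. Voisin, *Hodge Theory and Complex Algebraic Geometry I*, Cambridge Studies in Advanced
  Mathematics 76 (2002), §6.1.2: Thm. 6.7, Cor. 6.8, Cor. 6.9 — the intended (complex-manifold)
  statements. [cite: Voisin2002, §6.1.2 Cor. 6.9]
-/

noncomputable section

open scoped Manifold ContDiff Topology ComplexConjugate InnerProductSpace
open Bundle Module Set Filter ContinuousAlternatingMap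
open Literature.Geometry.Kaehler

namespace Literature.NumberTheory.Transcendental

namespace OriginConjAtlas

/-! ### The charted space: `ℂ` with the atlas `{id, conj}` -/

/-- A copy of the complex plane (one-field structure, so that no instance of `ℂ` — in particular
not `chartedSpaceSelf ℂ` — applies to it). [folklore] -/
@[ext]
structure Mc : Type where
  /-- the underlying complex number -/
  toC : ℂ

namespace Mc

/-- The topology of `ℂ` transported to `Mc`. [folklore] -/
instance : TopologicalSpace Mc := TopologicalSpace.induced Mc.toC inferInstance

/-- The tautological homeomorphism `Mc ≃ₜ ℂ`. [folklore] -/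
def toCHomeo : Mc ≃ₜ ℂ where
  toFun := Mc.toC
  invFun := Mc.mk
  left_inv _ := rfl
  right_inv _ := rfl
  continuous_toFun := continuous_induced_dom
  continuous_invFun := continuous_induced_rng.2 continuous_id

/-- Unfolding of `toCHomeo`. [folklore] -/
@[simp] theorem toCHomeo_apply (x : Mc) : toCHomeo x = x.toC := rfl
/-- Unfolding of `toCHomeo.symm`. [folklore] -/
@[simp] theorem toCHomeo_symm_apply (z : ℂ) : toCHomeo.symm z = ⟨z⟩ := rfl

/-- The exceptional point (the origin). [folklore] -/
def origin : Mc := ⟨0⟩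

/-- The origin is `0`. [folklore] -/
@[simp] theorem origin_toC : origin.toC = 0 := rfl

/-- The identity chart. [folklore] -/
def idChart : OpenPartialHomeomorph Mc ℂ := toCHomeo.toOpenPartialHomeomorph

/-- The complex-conjugate chart. [folklore] -/
def conjChart : OpenPartialHomeomorph Mc ℂ :=
  (toCHomeo.trans Complex.conjLIE.toHomeomorph).toOpenPartialHomeomorph

/-- Unfolding of the identity chart. [folklore] -/
@[simp] theorem idChart_apply (x : Mc) : idChart x = x.toC := rfl
/-- Unfolding of the inverse identity chart. [folklore] -/
@[simp] theorem idChart_symm_apply (z : ℂ) : idChart.symm z = ⟨z⟩ := rfl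
/-- Unfolding of the conjugate chart. [folklore] -/
@[simp] theorem conjChart_apply (x : Mc) : conjChart x = conj x.toC := rfl
/-- Unfolding of the inverse conjugate chart. [folklore] -/
@[simp] theorem conjChart_symm_apply (z : ℂ) : conjChart.symm z = ⟨conj z⟩ := rfl
/-- The identity chart is global. [folklore] -/
@[simp] theorem idChart_source : idChart.source = univ := rfl
/-- The conjugate chart is global. [folklore] -/
@[simp] theorem conjChart_source : conjChart.source = univ := rfl
/-- The identity chart is onto `ℂ`. [folklore] -/
@[simp] theorem idChart_target : idChart.target = univ := rfl
/-- The conjugate chart is onto `ℂ`. [folklore] -/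
@[simp] theorem conjChart_target : conjChart.target = univ := rfl

/-- The two charts differ (at `i`). [folklore] -/
theorem idChart_ne_conjChart : idChart ≠ conjChart := by
  intro h
  have := congrArg (fun e : OpenPartialHomeomorph Mc ℂ ↦ e ⟨Complex.I⟩) h
  simp [Complex.conj_I, eq_neg_iff_add_eq_zero] at this

/-- The charted-space structure on `Mc`: atlas `{id, conj}`, preferred chart `conj` at the origin
and `id` elsewhere. [folklore] -/
instance : ChartedSpace ℂ Mc where
  atlas := {idChart, conjChart}
  chartAt x := if x.toC = 0 then conjChart else idChart
  mem_chart_source x := by split_ifs <;> simp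
  chart_mem_atlas x := by split_ifs <;> simp

/-- The preferred chart (definitional). [folklore] -/
theorem chartAt_eq (x : Mc) : chartAt ℂ x = if x.toC = 0 then conjChart else idChart := rfl

/-- The preferred chart at the origin is `conj`. [folklore] -/
theorem chartAt_of_eq {x : Mc} (hx : x.toC = 0) : chartAt ℂ x = conjChart := by
  rw [chartAt_eq, if_pos hx]

/-- The preferred chart off the origin is `id`. [folklore] -/
theorem chartAt_of_ne {x : Mc} (hx : x.toC ≠ 0) : chartAt ℂ x = idChart := by
  rw [chartAt_eq, if_neg hx]

/-- Every preferred chart is global. [folklore] -/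
@[simp] theorem chartAt_source (x : Mc) : (chartAt ℂ x).source = univ := by
  rw [chartAt_eq]; split_ifs <;> rfl

/-- Every preferred chart is onto `ℂ`. [folklore] -/
@[simp] theorem chartAt_target (x : Mc) : (chartAt ℂ x).target = univ := by
  rw [chartAt_eq]; split_ifs <;> rfl

/-- Every extended chart is global. [folklore] -/
@[simp] theorem extChartAt_source' (x : Mc) : (extChartAt 𝓘(ℝ, ℂ) x).source = univ := by
  rw [extChartAt_source, chartAt_source]

/-- Every extended chart is onto `ℂ`. [folklore] -/
@[simp] theorem extChartAt_target' (x : Mc) : (extChartAt 𝓘(ℝ, ℂ) x).target = univ := by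
  rw [extChartAt_target, chartAt_target]; simp

/-- The preferred charts at `x` and `x'` coincide iff both or neither point is the origin.
[folklore] -/
theorem chartAt_eq_chartAt_iff (x x' : Mc) :
    chartAt ℂ x = chartAt ℂ x' ↔ (x.toC = 0 ↔ x'.toC = 0) := by
  by_cases hx : x.toC = 0 <;> by_cases hx' : x'.toC = 0 <;>
    simp [chartAt_eq, hx, hx', idChart_ne_conjChart, idChart_ne_conjChart.symm]

/-- The transition map between the preferred charts at `x` and `x'`, as a real continuous linear
map of `ℂ`: the identity if the two charts coincide, complex conjugation otherwise. [folklore] -/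
def τ (x x' : Mc) : ℂ →L[ℝ] ℂ :=
  if (x.toC = 0 ↔ x'.toC = 0) then ContinuousLinearMap.id ℝ ℂ else (Complex.conjCLE : ℂ →L[ℝ] ℂ)

/-- `τ` is an involution-valued cocycle: `τ x x' (τ x x' v) = v`. [folklore] -/
@[simp] theorem τ_τ_apply (x x' : Mc) (v : ℂ) : τ x x' (τ x x' v) = v := by
  unfold τ; split_ifs <;> simp

/-- `τ` preserves the real inner product of `ℂ` (`conj` is orthogonal). [folklore] -/
theorem inner_τ_τ (x x' : Mc) (v w : ℂ) : ⟪τ x x' v, τ x x' w⟫_ℝ = ⟪v, w⟫_ℝ := by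
  unfold τ; split_ifs
  · rfl
  · exact Complex.conjLIE.inner_map_map v w

/-- The transition functions written out: `extChartAt x' ∘ (extChartAt x).symm = τ x x'`.
[folklore] -/
theorem extChartAt_comp_extChartAt_symm (x x' : Mc) :
    (extChartAt 𝓘(ℝ, ℂ) x' : Mc → ℂ) ∘ (extChartAt 𝓘(ℝ, ℂ) x).symm = τ x x' := by
  funext z
  by_cases hx : x.toC = 0 <;> by_cases hx' : x'.toC = 0 <;>
    simp [τ, hx, hx', chartAt_of_eq, chartAt_of_ne]

/-- `Mc` is a real `C^∞` manifold (the transition maps `id`, `conj` are real-linear). [folklore] -/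
instance : IsManifold 𝓘(ℝ, ℂ) ∞ Mc := by
  refine isManifold_of_contDiffOn _ _ _ fun e e' he he' ↦ ?_
  have key : ∀ e e' : OpenPartialHomeomorph Mc ℂ, e ∈ atlas ℂ Mc → e' ∈ atlas ℂ Mc →
      ∃ L : ℂ →L[ℝ] ℂ, (𝓘(ℝ, ℂ) ∘ (e.symm ≫ₕ e') ∘ 𝓘(ℝ, ℂ).symm : ℂ → ℂ) = L := by
    rintro e e' (rfl | rfl) (rfl | rfl)
    · exact ⟨ContinuousLinearMap.id ℝ ℂ, by funext z; simp⟩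
    · exact ⟨Complex.conjCLE, by funext z; simp⟩
    · exact ⟨Complex.conjCLE, by funext z; simp⟩
    · exact ⟨ContinuousLinearMap.id ℝ ℂ, by funext z; simp⟩
  obtain ⟨L, hL⟩ := key e e' he he'
  rw [hL]
  exact L.contDiff.contDiffOn

/-- **The tangent coordinate changes of `Mc`** are the constant maps `τ`. [folklore] -/
theorem coordChange_eq (x x' z : Mc) :
    (tangentBundleCore 𝓘(ℝ, ℂ) Mc).coordChange (achart ℂ x) (achart ℂ x') z = τ x x' := by
  rw [tangentBundleCore_coordChange_achart, extChartAt_comp_extChartAt_symm,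
    ModelWithCorners.Boundaryless.range_eq_univ, fderivWithin_univ, ContinuousLinearMap.fderiv]

/-- Mathlib's `tangentCoordChange` of `Mc` is the constant `τ`. [folklore] -/
theorem tangentCoordChange_eq (x x' z : Mc) : tangentCoordChange 𝓘(ℝ, ℂ) x x' z = τ x x' :=
  coordChange_eq x x' z

/-- The chart representative of a form on `Mc`: `α.inChart x₀ y = τ^* (α z)`,
`z = (extChartAt x₀).symm y`. [folklore] -/
theorem inChart_eq {F : Type*} [NormedAddCommGroup F] [NormedSpace ℝ F] {k : ℕ}
    (α : MForm 𝓘(ℝ, ℂ) Mc F k) (x₀ : Mc) (y : ℂ) :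
    α.inChart x₀ y = (α ((extChartAt 𝓘(ℝ, ℂ) x₀).symm y)).compContinuousLinearMap
      (τ x₀ ((extChartAt 𝓘(ℝ, ℂ) x₀).symm y)) := by
  rw [α.inChart_eq_of_mem_target (by simp), tangentCoordChange_eq]

/-- The inverse extended chart at `x₀` is `conj` or `id`. [folklore] -/
@[simp] theorem extChartAt_symm_apply_toC (x₀ : Mc) (y : ℂ) :
    ((extChartAt 𝓘(ℝ, ℂ) x₀).symm y).toC = if x₀.toC = 0 then conj y else y := by
  by_cases hx : x₀.toC = 0 <;> simp [hx, chartAt_of_eq, chartAt_of_ne]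

/-- The extended chart at `x₀` is `conj` or `id`. [folklore] -/
@[simp] theorem extChartAt_apply (x₀ x : Mc) :
    extChartAt 𝓘(ℝ, ℂ) x₀ x = if x₀.toC = 0 then conj x.toC else x.toC := by
  by_cases hx : x₀.toC = 0 <;> simp [hx, chartAt_of_eq, chartAt_of_ne]

end Mc

open Mc

/-! ### The flat metric, as a `C^∞` Riemannian metric on `Mc` -/

set_option backward.isDefEq.respectTransparency false in
/-- **The flat metric** `g_x = Re ⟪·, ·⟫` on every tangent space `T_x Mc = ℂ` (chart coordinates),
as a `C^∞` Riemannian metric: its expression in the trivialisation of `Hom(T, Hom(T, ℝ))` at `x₀`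
is the constant `Re ⟪τ ·, τ ·⟫ = Re ⟪·, ·⟫`, `τ ∈ {id, conj}` being orthogonal
(`trivializationAt_bilinForm_apply₂`). [folklore] -/
def metric : ContMDiffRiemannianMetric 𝓘(ℝ, ℂ) ∞ ℂ (fun x : Mc ↦ TangentSpace 𝓘(ℝ, ℂ) x) where
  inner _ := (innerSL ℝ (E := ℂ) : ℂ →L[ℝ] ℂ →L[ℝ] ℝ)
  symm _ v w := by
    change @inner ℝ ℂ _ v w = @inner ℝ ℂ _ w v
    exact real_inner_comm _ _
  pos _ v hv := by
    change 0 < @inner ℝ ℂ _ v v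
    exact real_inner_self_pos.2 hv
  isVonNBounded _ := by
    change Bornology.IsVonNBounded ℝ {v : ℂ | @inner ℝ ℂ _ v v < 1}
    have : Metric.ball (0 : ℂ) 1 = {v : ℂ | @inner ℝ ℂ _ v v < 1} := by
      ext v
      simp only [Metric.mem_ball, dist_zero_right, norm_eq_sqrt_re_inner (𝕜 := ℝ),
        RCLike.re_to_real, Set.mem_setOf_eq]
      conv_lhs => rw [show (1 : ℝ) = √1 by simp]
      rw [Real.sqrt_lt_sqrt_iff]
      exact real_inner_self_nonneg
    rw [← this]
    exact NormedSpace.isVonNBounded_ball ℝ ℂ 1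
  contMDiff := by
    intro x₀
    rw [contMDiffAt_section]
    convert! contMDiffAt_const (c := (innerSL ℝ (E := ℂ) : ℂ →L[ℝ] ℂ →L[ℝ] ℝ))
    rename_i x
    ext v w
    rw [trivializationAt_bilinForm_apply₂,
      TangentBundle.symmL_trivializationAt_eq_core (by simp : x ∈ (chartAt ℂ x₀).source),
      coordChange_eq]
    exact inner_τ_τ x₀ x v w

/-- The flat metric as a `RiemannianBundle` structure (a reducible `def`, used as a *local*
instance below; it is the instance `⟨g.toRiemannianMetric⟩` installed by the fact under
refutation). [folklore] -/
@[reducible]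
def bundle : RiemannianBundle (fun x : Mc ↦ TangentSpace 𝓘(ℝ, ℂ) x) := ⟨metric.toRiemannianMetric⟩

section WithMetric

attribute [local instance] bundle Complex.finrank_real_complex_fact

/-- `⟪u, v⟫ = Re u Re v + Im u Im v` on `T_x Mc` for the flat metric. [folklore] -/
theorem inner_eq (x : Mc) (u v : TangentSpace 𝓘(ℝ, ℂ) x) :
    ⟪u, v⟫_ℝ = Complex.re u * Complex.re v + Complex.im u * Complex.im v := by
  change @inner ℝ ℂ _ u v = _
  rw [Complex.inner, Complex.mul_re, Complex.conj_re, Complex.conj_im]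
  ring

/-- The basis `1, i` of `T_x Mc = ℂ`. [folklore] -/
def basisT (x : Mc) : Basis (Fin 2) ℝ (TangentSpace 𝓘(ℝ, ℂ) x) := Complex.basisOneI

/-- `basisT = (1, i)`. [folklore] -/
theorem basisT_apply (x : Mc) (i : Fin 2) : basisT x i = (![1, Complex.I] : Fin 2 → ℂ) i :=
  congrFun Complex.coe_basisOneI i

/-- Coordinates in `basisT` are `(Re, Im)`. [folklore] -/
theorem basisT_repr (x : Mc) (v : TangentSpace 𝓘(ℝ, ℂ) x) (i : Fin 2) :
    (basisT x).repr v i = ![Complex.re v, Complex.im v] i :=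
  congrFun (Complex.coe_basisOneI_repr v) i

/-- `1, i` is orthonormal for the flat metric. [folklore] -/
theorem basisT_orthonormal (x : Mc) : Orthonormal ℝ (basisT x) := by
  rw [orthonormal_iff_ite]
  intro i j
  fin_cases i <;> fin_cases j <;> rw [inner_eq] <;> simp [basisT_apply]

/-- The orthonormal basis `1, i` of `T_x Mc`. [folklore] -/
def onBasis (x : Mc) : OrthonormalBasis (Fin 2) ℝ (TangentSpace 𝓘(ℝ, ℂ) x) :=
  (basisT x).toOrthonormalBasis (basisT_orthonormal x)

/-- The underlying basis of `onBasis` is `basisT`. [folklore] -/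
theorem toBasis_onBasis (x : Mc) : (onBasis x).toBasis = basisT x :=
  Basis.toBasis_toOrthonormalBasis _ _

/-- The standard orientation of `ℂ` on `T_x Mc` (chart coordinates). [folklore] -/
def stdOrient (x : Mc) : Orientation ℝ (TangentSpace 𝓘(ℝ, ℂ) x) (Fin 2) := (basisT x).orientation

/-- **The orientation family**: the standard orientation of the chart coordinates off the origin,
the reversed one at the origin (where the chart is `conj`) — i.e. the standard orientation of the
plane read in the preferred charts. [folklore] -/
def orient (x : Mc) : Orientation ℝ (TangentSpace 𝓘(ℝ, ℂ) x) (Fin 2) :=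
  if x.toC = 0 then -stdOrient x else stdOrient x

/-- The sign `ε x = -1` at the origin, `+1` elsewhere. [folklore] -/
def sgn (x : Mc) : ℝ := if x.toC = 0 then -1 else 1

/-- The standard determinant `det₀(v, w) = Re v Im w - Im v Re w`. [folklore] -/
theorem basisT_det_apply (x : Mc) (v : Fin 2 → TangentSpace 𝓘(ℝ, ℂ) x) :
    (basisT x).det v = Complex.re (v 0) * Complex.im (v 1) - Complex.im (v 0) * Complex.re (v 1) := by
  rw [Basis.det_apply, Matrix.det_fin_two]
  simp only [Basis.toMatrix_apply, basisT_repr]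
  simp
  ring

/-- The volume form of the standard orientation is `det₀`. [folklore] -/
theorem volumeForm_stdOrient (x : Mc) (v : Fin 2 → TangentSpace 𝓘(ℝ, ℂ) x) :
    (stdOrient x).volumeForm v = (basisT x).det v := by
  have ho : (onBasis x).toBasis.orientation = stdOrient x := by rw [toBasis_onBasis]; rfl
  rw [Orientation.volumeForm_robust _ (onBasis x) ho, toBasis_onBasis]

/-- **The Riemannian volume form** of `(Mc, g, o)`: `vol_x = ε(x) det₀`. [folklore] -/
theorem riemannianVolumeForm_apply (x : Mc) (v : Fin 2 → TangentSpace 𝓘(ℝ, ℂ) x) :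
    riemannianVolumeForm orient x v = sgn x * (basisT x).det v := by
  rw [Literature.Geometry.Kaehler.riemannianVolumeForm_apply, Orientation.volumeFormL_apply]
  unfold orient sgn
  split_ifs
  · rw [Orientation.volumeForm_neg_orientation, AlternatingMap.neg_apply, volumeForm_stdOrient]
    ring
  · rw [volumeForm_stdOrient]; ring

/-! ### Generic helpers: forms with constant or jumping chart representatives -/

/-- A form on `Mc` whose chart representative at `x` has vanishing derivative at the centre has
`dα(x) = 0` (unfolding of `mextDeriv`). [folklore] -/
theorem mextDeriv_apply_eq_zero {F : Type*} [NormedAddCommGroup F] [NormedSpace ℝ F] {k : ℕ}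
    {α : MForm 𝓘(ℝ, ℂ) Mc F k} {x : Mc}
    (h : fderivWithin ℝ (α.inChart x) (range 𝓘(ℝ, ℂ)) (extChartAt 𝓘(ℝ, ℂ) x x) = 0) :
    mextDeriv α x = 0 := by
  rw [mextDeriv, extDerivWithin, h]
  ext v
  simp [ContinuousAlternatingMap.alternatizeUncurryFin_apply]

/-- A function of `ℂ` which is `a` at `0` and `b ≠ a` on `ℂ ∖ {0}` is not continuous at `0`.
[folklore] -/
theorem not_continuousAt_of_jump {X : Type*} [TopologicalSpace X] [T2Space X] {f : ℂ → X}
    {a b : X} (hab : a ≠ b) (hf : ∀ y, f y = if y = 0 then a else b) : ¬ ContinuousAt f 0 := by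
  intro hc
  have h1 : Tendsto f (𝓝[≠] (0 : ℂ)) (𝓝 a) := by
    have h0 : f 0 = a := by rw [hf, if_pos rfl]
    have := hc.tendsto.mono_left (nhdsWithin_le_nhds (s := {(0 : ℂ)}ᶜ))
    rwa [h0] at this
  have h2 : Tendsto f (𝓝[≠] (0 : ℂ)) (𝓝 b) := by
    refine (tendsto_const_nhds (x := b)).congr' ?_
    filter_upwards [self_mem_nhdsWithin] with y hy
    rw [hf, if_neg (by simpa using hy)]
  exact hab (tendsto_nhds_unique h1 h2)

/-- The sign of the transition `τ x x'`: `+1` if the charts agree, `-1` otherwise. [folklore] -/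
def τsgn (x x' : Mc) : ℝ := if (x.toC = 0 ↔ x'.toC = 0) then 1 else -1

/-- The cocycle relation `ε(x') · τsgn(x, x') = ε(x)`. [folklore] -/
theorem sgn_mul_τsgn (x x' : Mc) : sgn x' * τsgn x x' = sgn x := by
  unfold sgn τsgn
  by_cases hx : x.toC = 0 <;> by_cases hx' : x'.toC = 0 <;> simp [hx, hx']

/-- The transition map `τ x₀ z`, typed as a map into the tangent space at `z` (the type at which
it enters the chart representatives `MForm.inChart`). [folklore] -/
def τT (x₀ z : Mc) : ℂ →L[ℝ] TangentSpace 𝓘(ℝ, ℂ) z := τ x₀ z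

/-- `Re ∘ τ = Re`. [folklore] -/
theorem re_τT (x₀ z : Mc) (w : ℂ) : Complex.re (τT x₀ z w) = Complex.re w := by
  change Complex.re (τ x₀ z w) = _
  unfold τ; split_ifs <;> simp

/-- `Im ∘ τ = ± Im`. [folklore] -/
theorem im_τT (x₀ z : Mc) (w : ℂ) : Complex.im (τT x₀ z w) = τsgn x₀ z * Complex.im w := by
  change Complex.im (τ x₀ z w) = _
  unfold τ τsgn; split_ifs <;> simp

/-- **Values of the chart representative** of a form on `Mc`:
`(α.inChart x₀ y)(v) = α_z (τ v)`, `z = (extChartAt x₀).symm y`. [folklore] -/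
theorem inChart_apply' {F : Type*} [NormedAddCommGroup F] [NormedSpace ℝ F] {k : ℕ}
    (α : MForm 𝓘(ℝ, ℂ) Mc F k) (x₀ : Mc) (y : ℂ) (v : Fin k → ℂ) :
    α.inChart x₀ y v = α ((extChartAt 𝓘(ℝ, ℂ) x₀).symm y)
      (fun i ↦ τT x₀ ((extChartAt 𝓘(ℝ, ℂ) x₀).symm y) (v i)) := by
  rw [inChart_eq, ContinuousAlternatingMap.compContinuousLinearMap_apply]
  rfl

/-- `z = (extChartAt x₀).symm y` is the origin iff `y = 0` (both charts fix `0`). [folklore] -/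
theorem τsgn_extChartAt_symm (x₀ : Mc) (y : ℂ) :
    τsgn x₀ ((extChartAt 𝓘(ℝ, ℂ) x₀).symm y) = if (x₀.toC = 0 ↔ y = 0) then 1 else -1 := by
  unfold τsgn
  by_cases hx : x₀.toC = 0 <;> simp [hx, chartAt_of_eq, chartAt_of_ne]

/-! ### Reference forms on the model space `ℂ`: `det₀ = dx ∧ dy`, `dx`, `dy` -/

/-- `det₀ = dx ∧ dy`, the volume form of the standard orientation of `ℂ`. [folklore] -/
def det₀ : ℂ [⋀^Fin 2]→L[ℝ] ℝ := Complex.orientation.volumeFormL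

/-- `det₀(v, w) = Re v Im w - Im v Re w` (Mathlib's `Complex.areaForm` computation). [folklore] -/
theorem det₀_apply (v : Fin 2 → ℂ) :
    det₀ v = Complex.re (v 0) * Complex.im (v 1) - Complex.im (v 0) * Complex.re (v 1) := by
  rw [det₀, Orientation.volumeFormL_apply,
    Complex.orientation.volumeForm_robust Complex.orthonormalBasisOneI rfl, Basis.det_apply,
    Matrix.det_fin_two]
  simp only [Basis.toMatrix_apply, Complex.toBasis_orthonormalBasisOneI, Complex.coe_basisOneI_repr,
    Matrix.cons_val_zero, Matrix.cons_val_one, Matrix.cons_val_fin_one]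
  ring

/-- `det₀ ≠ -det₀` (evaluate at `(1, i)`). [folklore] -/
theorem det₀_ne_neg : (1 : ℝ) • det₀ ≠ (-1 : ℝ) • det₀ := by
  intro h
  have := congrArg (fun f : ℂ [⋀^Fin 2]→L[ℝ] ℝ ↦ f ![1, Complex.I]) h
  simp only [ContinuousAlternatingMap.smul_apply, det₀_apply, smul_eq_mul] at this
  norm_num at this

/-- The `1`-form `dx = Re` on the model space. [folklore] -/
def dx₀ : ℂ [⋀^Fin 1]→L[ℝ] ℝ := ofSubsingleton ℝ ℂ ℝ (0 : Fin 1) Complex.reCLM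

/-- The `1`-form `dy = Im` on the model space. [folklore] -/
def dy₀ : ℂ [⋀^Fin 1]→L[ℝ] ℝ := ofSubsingleton ℝ ℂ ℝ (0 : Fin 1) Complex.imCLM

/-- `dx(v) = Re v`. [folklore] -/
@[simp] theorem dx₀_apply (v : Fin 1 → ℂ) : dx₀ v = Complex.re (v 0) := by simp [dx₀]

/-- `dy(v) = Im v`. [folklore] -/
@[simp] theorem dy₀_apply (v : Fin 1 → ℂ) : dy₀ v = Complex.im (v 0) := by simp [dy₀]

/-- `dy ≠ -dy` (evaluate at `i`). [folklore] -/
theorem dy₀_ne_neg : (1 : ℝ) • dy₀ ≠ (-1 : ℝ) • dy₀ := by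
  intro h
  have := congrArg (fun f : ℂ [⋀^Fin 1]→L[ℝ] ℝ ↦ f ![Complex.I]) h
  simp only [ContinuousAlternatingMap.smul_apply, dy₀_apply, smul_eq_mul] at this
  norm_num at this

/-! ### The volume form and the Kähler form -/

/-- The volume form of `o`: `vol_x = ε(x) det` on `T_x Mc`. [folklore] -/
theorem volumeForm_orient (x : Mc) (v : Fin 2 → TangentSpace 𝓘(ℝ, ℂ) x) :
    (orient x).volumeForm v = sgn x * (basisT x).det v := by
  unfold orient sgn
  split_ifs
  · rw [Orientation.volumeForm_neg_orientation, AlternatingMap.neg_apply, volumeForm_stdOrient]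
    ring
  · rw [volumeForm_stdOrient]; ring

/-- `vol_x(v) = ε(x) det₀(v)` (values of the Riemannian volume form). [folklore] -/
theorem riemannianVolumeForm_apply' (x : Mc) (v : Fin 2 → TangentSpace 𝓘(ℝ, ℂ) x) :
    riemannianVolumeForm orient x v =
      sgn x * (Complex.re (v 0) * Complex.im (v 1) - Complex.im (v 0) * Complex.re (v 1)) := by
  rw [Literature.Geometry.Kaehler.riemannianVolumeForm_apply, Orientation.volumeFormL_apply,
    volumeForm_orient, basisT_det_apply]

/-- The chart representatives of the volume form are constant: `vol.inChart x₀ = ε(x₀) det₀`.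
[folklore] -/
theorem inChart_riemannianVolumeForm (x₀ : Mc) (y : ℂ) :
    (riemannianVolumeForm orient).inChart x₀ y = sgn x₀ • det₀ := by
  ext v
  rw [inChart_apply', riemannianVolumeForm_apply', ContinuousAlternatingMap.smul_apply, smul_eq_mul,
    det₀_apply]
  simp only [re_τT, im_τT]
  rw [← sgn_mul_τsgn x₀ ((extChartAt 𝓘(ℝ, ℂ) x₀).symm y)]
  ring

/-- **The hypothesis `ho`**: the volume form of `(Mc, g, o)` is smooth. [folklore] -/
theorem isSmoothForm_riemannianVolumeForm : IsSmoothForm (riemannianVolumeForm orient) := by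
  intro x
  rw [funext (inChart_riemannianVolumeForm x)]
  exact contDiffWithinAt_const

/-- **`g` is Hermitian**: `Re ⟪iv, iw⟫ = Re ⟪v, w⟫` at every point. [folklore] -/
theorem isHermitian : Bundle.RiemannianMetric.IsHermitian metric.toRiemannianMetric := by
  intro x v w
  change @inner ℝ ℂ _ (Complex.I * show ℂ from v) (Complex.I * show ℂ from w) =
    @inner ℝ ℂ _ (show ℂ from v) (show ℂ from w)
  rw [Complex.inner, Complex.inner]
  simp only [map_mul, Complex.conj_I]
  ring_nf
  simp

/-- **The Kähler form is `det₀` at every point** (values: `ω(v, w) = Re ⟪iv, w⟫`). [folklore] -/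
theorem kaehlerForm_apply' (x : Mc) (v : Fin 2 → TangentSpace 𝓘(ℝ, ℂ) x) :
    metric.toRiemannianMetric.kaehlerForm x v =
      Complex.re (v 0) * Complex.im (v 1) - Complex.im (v 0) * Complex.re (v 1) := by
  obtain ⟨a, b, rfl⟩ : ∃ a b : TangentSpace 𝓘(ℝ, ℂ) x, v = ![a, b] :=
    ⟨v 0, v 1, by funext i; fin_cases i <;> rfl⟩
  rw [Bundle.RiemannianMetric.kaehlerForm_apply_of_isHermitian _ isHermitian]
  simp only [Matrix.cons_val_zero, Matrix.cons_val_one, Matrix.cons_val_fin_one]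
  change @inner ℝ ℂ _ (Complex.I * show ℂ from a) (show ℂ from b) = _
  rw [Complex.inner]
  simp only [map_mul, Complex.conj_I, Complex.mul_re, Complex.mul_im, Complex.neg_re,
    Complex.neg_im, Complex.I_re, Complex.I_im, Complex.conj_re, Complex.conj_im, neg_mul]
  ring

/-- The chart representative of the Kähler form: `± det₀` according as the chart at the point
agrees with the chart at `x₀`. [folklore] -/
theorem inChart_kaehlerForm (x₀ : Mc) (y : ℂ) :
    (metric.toRiemannianMetric.kaehlerForm).inChart x₀ y =
      (if (x₀.toC = 0 ↔ y = 0) then (1 : ℝ) else -1) • det₀ := by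
  ext v
  rw [inChart_apply', kaehlerForm_apply', ContinuousAlternatingMap.smul_apply, smul_eq_mul,
    det₀_apply, ← τsgn_extChartAt_symm]
  simp only [re_τT, im_τT]
  ring

/-- **The Kähler form is closed** in the sense of `IsClosedForm` (`mextDeriv ω = 0`): off the
origin its chart representative is locally the constant `det₀`; at the origin it jumps
(`det₀` at the centre, `-det₀` on the punctured plane), is not differentiable, and Mathlib's
`fderivWithin` returns the junk value `0`. [folklore] -/
theorem isClosedForm_kaehlerForm : IsClosedForm metric.toRiemannianMetric.kaehlerForm := by
  funext x₀
  rw [Pi.zero_apply]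
  apply mextDeriv_apply_eq_zero
  rw [ModelWithCorners.Boundaryless.range_eq_univ, Mc.extChartAt_apply]
  by_cases hx : x₀.toC = 0
  · -- the origin: the representative jumps, junk derivative `0`
    rw [if_pos hx, hx, _root_.map_zero]
    apply fderivWithin_zero_of_not_differentiableWithinAt
    intro hd
    have hc : ContinuousAt (metric.toRiemannianMetric.kaehlerForm.inChart x₀) 0 := by
      simpa [continuousWithinAt_univ] using hd.continuousWithinAt
    refine not_continuousAt_of_jump det₀_ne_neg (fun y ↦ ?_) hc
    rw [inChart_kaehlerForm]
    simp only [hx, true_iff]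
    split_ifs <;> rfl
  · -- off the origin: locally constant
    rw [if_neg hx]
    have hev : metric.toRiemannianMetric.kaehlerForm.inChart x₀ =ᶠ[𝓝[univ] x₀.toC]
        fun _ ↦ det₀ := by
      rw [nhdsWithin_univ]
      filter_upwards [isOpen_compl_singleton.mem_nhds (by simpa using hx)] with y hy
      rw [inChart_kaehlerForm]
      simp only [mem_compl_iff, mem_singleton_iff] at hy
      simp [hx, hy]
    rw [hev.fderivWithin_eq (by simp [inChart_kaehlerForm, hx]), fderivWithin_const_apply]

/-- **`g` is a Kähler metric** on `Mc` in the sense of `Bundle.RiemannianMetric.IsKaehler`.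
[folklore] -/
theorem isKaehler : Bundle.RiemannianMetric.IsKaehler metric.toRiemannianMetric :=
  ⟨isHermitian, isClosedForm_kaehlerForm⟩

/-! ### The harmonic `1`-form `dx` -/

/-- `Re` and `Im` as real functionals on `T_x Mc = ℂ`. [folklore] -/
def reT (x : Mc) : TangentSpace 𝓘(ℝ, ℂ) x →L[ℝ] ℝ := Complex.reCLM

/-- `Im` as a real functional on `T_x Mc = ℂ`. [folklore] -/
def imT (x : Mc) : TangentSpace 𝓘(ℝ, ℂ) x →L[ℝ] ℝ := Complex.imCLM

/-- **The `1`-form `dx`** on `Mc` (`Re` at every point, in the preferred chart coordinates; since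
`Re ∘ conj = Re` this is the differential of the global coordinate `Re`). [folklore] -/
def dx : MForm 𝓘(ℝ, ℂ) Mc ℝ 1 := fun x ↦ ofSubsingleton ℝ (TangentSpace 𝓘(ℝ, ℂ) x) ℝ (0 : Fin 1) (reT x)

/-- The `1`-form `Im` at every point (chart coordinates): as a form on the plane this is `± dy`,
the sign flipping at the origin. [folklore] -/
def dy : MForm 𝓘(ℝ, ℂ) Mc ℝ 1 := fun x ↦ ofSubsingleton ℝ (TangentSpace 𝓘(ℝ, ℂ) x) ℝ (0 : Fin 1) (imT x)

/-- `dx(v) = Re v` at every point. [folklore] -/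
theorem dx_apply (x : Mc) (v : Fin 1 → TangentSpace 𝓘(ℝ, ℂ) x) : dx x v = Complex.re (v 0) := by
  rfl

/-- `dy(v) = Im v` at every point (chart coordinates). [folklore] -/
theorem dy_apply (x : Mc) (v : Fin 1 → TangentSpace 𝓘(ℝ, ℂ) x) : dy x v = Complex.im (v 0) := by
  rfl

/-- The chart representatives of `dx` are the constant `dx₀`. [folklore] -/
theorem inChart_dx (x₀ : Mc) (y : ℂ) : dx.inChart x₀ y = dx₀ := by
  ext v
  rw [inChart_apply', dx_apply, dx₀_apply]
  exact re_τT _ _ _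

/-- The chart representatives of `dy` are `± dy₀`. [folklore] -/
theorem inChart_dy (x₀ : Mc) (y : ℂ) :
    dy.inChart x₀ y = (if (x₀.toC = 0 ↔ y = 0) then (1 : ℝ) else -1) • dy₀ := by
  ext v
  rw [inChart_apply', dy_apply, ContinuousAlternatingMap.smul_apply, dy₀_apply, smul_eq_mul,
    ← τsgn_extChartAt_symm]
  exact im_τT _ _ _

/-- `dx` is smooth. [folklore] -/
theorem isSmoothForm_dx : IsSmoothForm dx := by
  intro x
  rw [funext (inChart_dx x)]
  exact contDiffWithinAt_const

/-- `d(dx) = 0`. [folklore] -/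
theorem mextDeriv_dx : mextDeriv dx = 0 := by
  funext x
  exact mextDeriv_apply_eq_zero (by rw [funext (inChart_dx x), fderivWithin_const_apply])

/-- `dx = ⟪1, ·⟫` for the flat metric. [folklore] -/
theorem reT_eq_innerSL (x : Mc) :
    (reT x : TangentSpace 𝓘(ℝ, ℂ) x →L[ℝ] ℝ) =
      innerSL ℝ (E := TangentSpace 𝓘(ℝ, ℂ) x) ((1 : ℂ) : TangentSpace 𝓘(ℝ, ℂ) x) := by
  ext w
  rw [innerSL_apply_apply, inner_eq]
  change Complex.re w = _
  simp

/-- **`⋆dx = ε dy`**: the Hodge star of `dx` evaluated on `w` is `ε(x) Im w`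
(`⋆⟪v, ·⟫ = ω_o(v, ·)`, `hodgeStar_apply_eq_areaForm_holds`). [folklore] -/
theorem hodgeStar_dx_apply (h : 1 + 1 = 2) (x : Mc) (w : TangentSpace 𝓘(ℝ, ℂ) x) :
    MForm.hodgeStar orient h dx x ![w] = sgn x * Complex.im w := by
  rw [MForm.hodgeStar_apply]
  change hodgeStar (orient x) h (ofSubsingleton ℝ (TangentSpace 𝓘(ℝ, ℂ) x) ℝ (0 : Fin 1) (reT x))
    ![w] = _
  rw [reT_eq_innerSL x, hodgeStar_apply_eq_areaForm_holds (orient x) h,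
    Orientation.areaForm_to_volumeForm, volumeForm_orient, basisT_det_apply]
  simp

/-- `⋆dx = ε(x) dy` pointwise. [folklore] -/
theorem hodgeStar_dx (h : 1 + 1 = 2) (x : Mc) : MForm.hodgeStar orient h dx x = sgn x • dy x := by
  ext v
  obtain ⟨w, rfl⟩ : ∃ w, v = ![w] := ⟨v 0, by funext i; fin_cases i; rfl⟩
  rw [hodgeStar_dx_apply, ContinuousAlternatingMap.smul_apply, dy_apply, smul_eq_mul]
  rfl

/-- The chart representatives of `⋆dx` are the constant `ε(x₀) dy₀`. [folklore] -/
theorem inChart_hodgeStar_dx (h : 1 + 1 = 2) (x₀ : Mc) (y : ℂ) :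
    (MForm.hodgeStar orient h dx).inChart x₀ y = sgn x₀ • dy₀ := by
  ext v
  rw [inChart_apply', hodgeStar_dx, ContinuousAlternatingMap.smul_apply, dy_apply,
    ContinuousAlternatingMap.smul_apply, dy₀_apply, smul_eq_mul, smul_eq_mul]
  simp only [im_τT]
  rw [← sgn_mul_τsgn x₀ ((extChartAt 𝓘(ℝ, ℂ) x₀).symm y)]
  ring

/-- `d(⋆dx) = 0`. [folklore] -/
theorem mextDeriv_hodgeStar_dx (h : 1 + 1 = 2) : mextDeriv (MForm.hodgeStar orient h dx) = 0 := by
  funext x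
  exact mextDeriv_apply_eq_zero (by rw [funext (inChart_hodgeStar_dx h x), fderivWithin_const_apply])

/-- `δ(dx) = 0`. [folklore] -/
theorem mcoderiv_dx (h : 0 + 1 + 1 = 2) : mcoderiv orient h dx = 0 := by
  rw [mcoderiv, mextDeriv_hodgeStar_dx, _root_.map_zero, smul_zero]

/-- `δ 0 = 0`. [folklore] -/
theorem mcoderiv_zero {k m : ℕ} (h : k + 1 + m = 2) :
    mcoderiv orient h (0 : MForm 𝓘(ℝ, ℂ) Mc ℝ (k + 1)) = 0 := by
  rw [mcoderiv, _root_.map_zero, mextDeriv_zero, _root_.map_zero, smul_zero]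

/-- **`Δ dx = 0`**: `dx` is harmonic. [folklore] -/
theorem hodgeLaplacian_dx (h : 1 + 1 = 2) : hodgeLaplacian orient 1 1 h dx = 0 := by
  change mextDeriv (mcoderiv orient (m := 1) h dx) +
    mcoderiv orient (m := 0) (show (0 + 1 + 1) + 0 = 2 by norm_num) (mextDeriv dx) = 0
  rw [mcoderiv_dx, mextDeriv_zero, mextDeriv_dx, mcoderiv_zero, add_zero]

/-- `dx` is a harmonic form. [folklore] -/
theorem isHarmonicForm_dx (h : 1 + 1 = 2) : IsHarmonicForm orient h dx :=
  ⟨isSmoothForm_dx, hodgeLaplacian_dx h⟩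

/-- `dx ∈ ℋ¹`. [folklore] -/
theorem dx_mem_harmonicForms (h : 1 + 1 = 2) : dx ∈ harmonicForms orient h :=
  subset_harmonicForms orient h (isHarmonicForm_dx h)

/-! ### The `(1,0)`-component of `dx` -/

/-- The identity of `T_x Mc = ℂ`, as a real-linear map into `ℂ`. [folklore] -/
def idT (x : Mc) : TangentSpace 𝓘(ℝ, ℂ) x →L[ℝ] ℂ := ContinuousLinearMap.id ℝ ℂ

/-- Complex conjugation of `T_x Mc = ℂ`, as a real-linear map into `ℂ`. [folklore] -/
def conjT (x : Mc) : TangentSpace 𝓘(ℝ, ℂ) x →L[ℝ] ℂ := (Complex.conjCLE : ℂ →L[ℝ] ℂ)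

/-- The complex `1`-form `dz` (the identity at every point, chart coordinates). [folklore] -/
def dz : MForm 𝓘(ℝ, ℂ) Mc ℂ 1 := fun x ↦ ofSubsingleton ℝ (TangentSpace 𝓘(ℝ, ℂ) x) ℂ (0 : Fin 1) (idT x)

/-- The complex `1`-form `dz̄` (conjugation at every point, chart coordinates). [folklore] -/
def dzbar : MForm 𝓘(ℝ, ℂ) Mc ℂ 1 :=
  fun x ↦ ofSubsingleton ℝ (TangentSpace 𝓘(ℝ, ℂ) x) ℂ (0 : Fin 1) (conjT x)

/-- `dz(v) = v`. [folklore] -/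
theorem dz_apply (x : Mc) (v : Fin 1 → TangentSpace 𝓘(ℝ, ℂ) x) : dz x v = (v 0 : ℂ) := by rfl

/-- `dz̄(v) = v̄`. [folklore] -/
theorem dzbar_apply (x : Mc) (v : Fin 1 → TangentSpace 𝓘(ℝ, ℂ) x) :
    dzbar x v = (starRingEnd ℂ) (v 0 : ℂ) := by
  rfl

/-- `dz` has type `(1,0)`. [folklore] -/
theorem isOfType_dz : IsOfType 1 0 dz := by
  refine ⟨rfl, fun x θ v ↦ ?_⟩
  rw [dz_apply, dz_apply, tangentRotate_apply]
  simp

/-- `dz̄` has type `(0,1)`. [folklore] -/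
theorem isOfType_dzbar : IsOfType 0 1 dzbar := by
  refine ⟨rfl, fun x θ v ↦ ?_⟩
  rw [dzbar_apply, dzbar_apply, tangentRotate_apply]
  simp only [smul_eq_mul, map_mul, ← Complex.exp_conj, Complex.conj_ofReal, Complex.conj_I,
    Nat.cast_zero, Nat.cast_one, zero_sub, Int.cast_neg, Int.cast_one]
  ring_nf

/-- `dx ⊗ 1 = ½ (dz + dz̄)`. [folklore] -/
theorem dx_ofReal : dx.ofReal = ((2⁻¹ : ℝ) : ℂ) • (dz + dzbar) := by
  funext x; ext v
  simp only [MForm.ofReal_apply, dx_apply, Pi.smul_apply, Pi.add_apply,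
    ContinuousAlternatingMap.smul_apply, ContinuousAlternatingMap.add_apply, dz_apply, dzbar_apply,
    smul_eq_mul]
  rw [Complex.re_eq_add_conj]
  push_cast
  ring

/-- **`(dx ⊗ 1)^{1,0} = ½ dz`.** [folklore] -/
theorem typeComponent_dx_ofReal : (dx.ofReal).typeComponent 1 0 = ((2⁻¹ : ℝ) : ℂ) • dz := by
  rw [dx_ofReal, MForm.typeComponent_smul, MForm.typeComponent_add, isOfType_dz.typeComponent_eq_self,
    IsOfType.typeComponent_of_ne_holds isOfType_dzbar (Or.inl (by norm_num)), add_zero]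

/-- **`Im (dx ⊗ 1)^{1,0} = ½ dy`.** [folklore] -/
theorem im_typeComponent_dx_ofReal : ((dx.ofReal).typeComponent 1 0).im = (2⁻¹ : ℝ) • dy := by
  rw [typeComponent_dx_ofReal]
  funext x; ext v
  simp only [MForm.im_apply, Pi.smul_apply, ContinuousAlternatingMap.smul_apply, dz_apply, dy_apply,
    smul_eq_mul, Complex.im_ofReal_mul]

/-- `Re (dx ⊗ 1)^{1,0} = ½ dx` (for the record). [folklore] -/
theorem re_typeComponent_dx_ofReal : ((dx.ofReal).typeComponent 1 0).re = (2⁻¹ : ℝ) • dx := by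
  rw [typeComponent_dx_ofReal]
  funext x; ext v
  simp only [MForm.re_apply, Pi.smul_apply, ContinuousAlternatingMap.smul_apply, dz_apply, dx_apply,
    smul_eq_mul, Complex.re_ofReal_mul]

/-! ### `dy` is not smooth at the origin -/

/-- The chart representative of `dy` at the origin: `dy₀` at the centre, `-dy₀` elsewhere.
[folklore] -/
theorem inChart_dy_origin (y : ℂ) : dy.inChart origin y = (if y = 0 then (1 : ℝ) else -1) • dy₀ := by
  rw [inChart_dy]
  simp

/-- **`dy` is not a smooth form on `Mc`**: its chart representative at the origin is not even
continuous at the centre. [folklore] -/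
theorem not_isSmoothForm_dy : ¬ IsSmoothForm dy := by
  intro H
  have h := H origin
  rw [ModelWithCorners.Boundaryless.range_eq_univ, contDiffWithinAt_univ, Mc.extChartAt_apply] at h
  simp only [origin_toC, if_true, _root_.map_zero] at h
  refine not_continuousAt_of_jump dy₀_ne_neg (fun y ↦ ?_) h.continuousAt
  rw [inChart_dy_origin]
  split_ifs <;> rfl

/-- Nonzero multiples of `dy` are not smooth either. [folklore] -/
theorem not_isSmoothForm_smul_dy {c : ℝ} (hc : c ≠ 0) : ¬ IsSmoothForm (c • dy) := fun H ↦
  not_isSmoothForm_dy (by simpa [smul_smul, inv_mul_cancel₀ hc] using H.smul c⁻¹)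

/-- Elements of `harmonicForms` are smooth (the span of smooth forms consists of smooth forms).
[folklore] -/
theorem isSmoothForm_of_mem_harmonicForms {k m : ℕ} (h : k + m = 2) {α : MForm 𝓘(ℝ, ℂ) Mc ℝ k}
    (hα : α ∈ harmonicForms orient h) : IsSmoothForm α :=
  (Submodule.span_le.2 (fun _ hβ ↦ hβ.1) : harmonicForms orient h ≤ smoothForms 𝓘(ℝ, ℂ) Mc ℝ k) hα

/-- Elements of `charmonicForms` are smooth. [folklore] -/
theorem isSmoothForm_of_mem_charmonicForms {k m : ℕ} (h : k + m = 2) {α : MForm 𝓘(ℝ, ℂ) Mc ℂ k}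
    (hα : α ∈ charmonicForms orient h) : IsSmoothForm α :=
  (mem_csmoothForms_iff α).1
    ((Submodule.span_le.2 (fun β hβ ↦ (mem_csmoothForms_iff β).2 hβ.1) :
      charmonicForms orient h ≤ csmoothForms ℂ Mc k) hα)

/-- `dx ⊗ 1 ∈ ℋ¹_ℂ` (`Δ_d (β ⊗ 1) = (Δ β) ⊗ 1`, `cHodgeLaplacian_ofReal_holds`). [folklore] -/
theorem dx_ofReal_mem_charmonicForms (h : 1 + 1 = 2) : dx.ofReal ∈ charmonicForms orient h :=
  Submodule.subset_span ⟨isSmoothForm_dx.ofReal, by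
    rw [cHodgeLaplacian_ofReal_holds orient h dx, hodgeLaplacian_dx, MForm.ofReal_zero]⟩

/-! ### The refutations -/

/-- **`typeComponent_mem_harmonicForms` fails for `(Mc, g, o)`** in degree `k = 1`
(`m = 1`, `n = 2`), type `(p, q) = (1, 0)`, and the harmonic form `β = dx`: the imaginary
part `½ dy` of `(dx ⊗ 1)^{1,0} = ½ dz` is not smooth, hence not in `harmonicForms`.
[folklore] -/
theorem not_typeComponent_mem_harmonicForms_originConjAtlas :
    ¬ typeComponent_mem_harmonicForms (k := 1) (m := 1) metric orient := by
  intro H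
  have h2 := (H isKaehler (by norm_num) 1 0 (β := dx) isSmoothForm_riemannianVolumeForm
    (dx_mem_harmonicForms _)).2
  rw [im_typeComponent_dx_ofReal] at h2
  exact not_isSmoothForm_smul_dy (by norm_num) (isSmoothForm_of_mem_harmonicForms _ h2)

/-- **`typeComponent_mem_charmonicForms` fails for `(Mc, g, o)`** likewise: `dx ⊗ 1` is
`Δ_d`-harmonic but its `(1,0)`-component `½ dz` is not smooth (its imaginary part is `½ dy`),
hence not in `charmonicForms`. [folklore] -/
theorem not_typeComponent_mem_charmonicForms_originConjAtlas :
    ¬ typeComponent_mem_charmonicForms (k := 1) (m := 1) metric orient := by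
  intro H
  have h := H isKaehler (by norm_num) 1 0 (α := dx.ofReal) isSmoothForm_riemannianVolumeForm
    (dx_ofReal_mem_charmonicForms _)
  have hs := (isSmoothForm_of_mem_charmonicForms _ h).im
  rw [im_typeComponent_dx_ofReal] at hs
  exact not_isSmoothForm_smul_dy (by norm_num) hs

end WithMetric

end OriginConjAtlas

section UniversalClosure

attribute [local instance] Complex.finrank_real_complex_fact

/-- **`typeComponent_mem_harmonicForms` cannot be discharged as stated**: its universal closure
over real `C^∞` surfaces charted in `ℂ` (smooth metric, any orientation family) is false —
witness `OriginConjAtlas.Mc` with the flat metric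
(`OriginConjAtlas.not_typeComponent_mem_harmonicForms_originConjAtlas`).
The intended statement is Voisin (2002), Cor. 6.9, for complex manifolds. [folklore] -/
theorem not_forall_typeComponent_mem_harmonicForms :
    ¬ ∀ (M : Type) [TopologicalSpace M] [ChartedSpace ℂ M] [IsManifold 𝓘(ℝ, ℂ) ∞ M]
        (g : ContMDiffRiemannianMetric 𝓘(ℝ, ℂ) ∞ ℂ (fun x : M ↦ TangentSpace 𝓘(ℝ, ℂ) x))
        (o : (x : M) → Orientation ℝ (TangentSpace 𝓘(ℝ, ℂ) x) (Fin 2)),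
        typeComponent_mem_harmonicForms (k := 1) (m := 1) g o :=
  fun H ↦ OriginConjAtlas.not_typeComponent_mem_harmonicForms_originConjAtlas
    (H OriginConjAtlas.Mc OriginConjAtlas.metric OriginConjAtlas.orient)

/-- **`typeComponent_mem_charmonicForms` cannot be discharged as stated** (same witness,
`OriginConjAtlas.not_typeComponent_mem_charmonicForms_originConjAtlas`). The intended statement is
Voisin (2002), Cor. 6.9, for complex manifolds. [folklore] -/
theorem not_forall_typeComponent_mem_charmonicForms :
    ¬ ∀ (M : Type) [TopologicalSpace M] [ChartedSpace ℂ M] [IsManifold 𝓘(ℝ, ℂ) ∞ M]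
        (g : ContMDiffRiemannianMetric 𝓘(ℝ, ℂ) ∞ ℂ (fun x : M ↦ TangentSpace 𝓘(ℝ, ℂ) x))
        (o : (x : M) → Orientation ℝ (TangentSpace 𝓘(ℝ, ℂ) x) (Fin 2)),
        typeComponent_mem_charmonicForms (k := 1) (m := 1) g o :=
  fun H ↦ OriginConjAtlas.not_typeComponent_mem_charmonicForms_originConjAtlas
    (H OriginConjAtlas.Mc OriginConjAtlas.metric OriginConjAtlas.orient)

end UniversalClosure

end Literature.NumberTheory.Transcendental
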